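/-
Copyright (c) 2026 The decomp-a2c cell. All rights reserved.
Released under Apache 2.0 license as described in the file LICENSE.
-/
import Summits.AtomisticToContinuum.Crystallization.Theorems.ChartedZeroExcessLayeredLatticeLiouvilleWO

/-!
# ChartedZeroExcessLayeredLatticeLiouville — part WP «SlopeMismatchReduction»: the planar-flux mismatch of the (PC) plan is the column planar
  flux of the SLOPE-DRIFT FIELD `φ − A`, whose in-plane increments are controlled pointwise on the half ball (decomp-a2c-lens-2, g58; helper
  of stmt-AtomisticToContinuum-26636, leaf (PC) `ProfileComparisonAt`; step (WP) of memo NODE-g58d §3–4 — the exact reduction, not yet the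
  kernel-weighted estimate)

With `A := modeField (slopeAt φ x₀) 0` (the affine part of `φ` at `x₀`, zero profile) and linearity of the WC fluxes:

* `planarFlux_sub`, `colPlanar_sub` — the planar / column planar flux is additive in the field;
* ★ `colPlanar_sub_boxSlope : colPlanar ϱ a b w T φ γ m − boxSlope ϱ a b w ⌊ϱ/c⌋₊ (slopeAt φ x₀) m = colPlanar ϱ a b w T (φ − A) γ m` for every
  carrier `T ⊇ [m − ⌊ϱ/c⌋₊, m + 1 + ⌊ϱ/c⌋₊]` (part WO's carrier check);
* `latDiff_sub_affine : latDiff E (φ − A) Z = latDiff E φ Z − latDiff E φ x₀` for in-plane unit steps `E` (`E.2 = 0`, `Σ_j E_j•slopeAt_j = D_Eφ(x₀)`),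
  in particular for the two axes; ★ `norm_latDiff_sub_affine_le`: on the half ball
  `‖latDiff E (φ − A) Z‖ ≤ √(864·ipConst·E/(n²·N)) · dist Z x₀` (part WM's slope drift, solved for the norm).

DESIGN NOTE for the successor (the estimate of `‖colPlanar T (φ − A) γ₀ m‖`): part WG's `norm_colPlanar_le` takes a UNIFORM bound `G` of the
in-plane increments over the whole `⌊ϱ/c⌋₊`-box and would give `108·K·δ₁·(|m − α₀| + 2⌊ϱ/c⌋₊ + 1)` — an additive `⌊ϱ/c⌋₊` at the centre, i.e. a
`ϱ`-DEPENDENT constant in (PC) (the same defect as the booked dead end `T = band(W)`).  The kernel-WEIGHTED form is required: bound each bond by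
`kernelConst·idxWt(Y − X)·‖(φ − A)(δ,β) − (φ − A)(γ₀,β)‖`, walk in the layer (`≤ 2N` steps, each `≤ δ₁·(|α − α₀| + 2N + 1)` by this part), so a
bond costs `≤ 6·K·δ₁·idxWt·N²·(|α − α₀| + 1)`; then sum over the cut `α ≤ m < β` using the DECAY in `β − α ≤ N`: a tail moment
`Σ_{Y : N(Y−X) ≥ t} idxWt(Y−X)·N(Y−X)² ≲ t⁻³` (shells `#{N = s} ≤ 50s²`, `idxWt·N² = s⁻⁶`) makes
`Σ_{α ≤ m} (|α−α₀|+1)·(m−α+1)⁻³ ≤ 3(|m−α₀|+1)`, all `ϱ`-free (critic row 1007 (ii)).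
-/

namespace Summit.AtomisticToContinuum.Crystallization.Theorems.ChartedZeroExcessLayeredLatticeLiouville

open Summit.AtomisticToContinuum.Crystallization.Theorems.ChartedPlanarOrderRigidityDoor (E3)
open Finset
open scoped InnerProductSpace RealInnerProductSpace BigOperators

noncomputable section SlopeMismatchReduction

variable {c : ℝ} {a b : E3} {w : ℤ → E3}

/-! ### WP.1  Linearity of the planar fluxes and the exact reduction -/

/-- the planar flux is additive in the field (subtraction form). [formal bookkeeping] -/
theorem planarFlux_sub (hc : 0 < c) (hL : IsLayeredCrystal c a b w) (ϱ : ℝ) (ψ₁ ψ₂ : Cell 2 → ℤ → E3) (X : Cell 2 × ℤ) (β : ℤ) :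
    planarFlux ϱ a b w (ψ₁ - ψ₂) X β = planarFlux ϱ a b w ψ₁ X β - planarFlux ϱ a b w ψ₂ X β := by
  have hN := mem_nearFinset_of_le hc hL ϱ X
  rw [planarFlux_eq_sum hN, planarFlux_eq_sum hN, planarFlux_eq_sum hN, ← sum_sub_distrib]
  refine sum_congr rfl fun Y _ => ?_
  rw [← nearK_sub]
  congr 1
  simp only [Pi.sub_apply]
  abel

/-- the column planar flux is additive in the field (subtraction form). [formal bookkeeping] -/
theorem colPlanar_sub (hc : 0 < c) (hL : IsLayeredCrystal c a b w) (ϱ : ℝ) (T : Finset ℤ) (ψ₁ ψ₂ : Cell 2 → ℤ → E3) (γ : Cell 2) (m : ℤ) :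
    colPlanar ϱ a b w T (ψ₁ - ψ₂) γ m = colPlanar ϱ a b w T ψ₁ γ m - colPlanar ϱ a b w T ψ₂ γ m := by
  simp only [colPlanar, cutSum, planarFlux_sub hc hL, sum_sub_distrib]

/-- ★ EXACT REDUCTION of the planar mismatch: `colPlanar(φ) − boxSlope(slopeAt φ x₀) = colPlanar(φ − A)` with `A = modeField (slopeAt φ x₀) 0` the
affine part of `φ` at `x₀`, for every carrier containing the band box (part WO `colPlanar_modeField`). [this file, g58] -/
theorem colPlanar_sub_boxSlope (hc : 0 < c) (hL : IsLayeredCrystal c a b w) {ϱ : ℝ} (φ : Cell 2 → ℤ → E3) (x₀ : Cell 2 × ℤ) {T : Finset ℤ}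
    {m : ℤ} (hT : Icc (m - ⌊ϱ / c⌋₊) (m + 1 + ⌊ϱ / c⌋₊) ⊆ T) (γ : Cell 2) :
    colPlanar ϱ a b w T φ γ m - boxSlope ϱ a b w ⌊ϱ / c⌋₊ (slopeAt φ x₀) m = colPlanar ϱ a b w T (φ - modeField (slopeAt φ x₀) 0) γ m := by
  rw [colPlanar_sub hc hL, colPlanar_modeField hc hL _ _ hT]

/-! ### WP.2  The slope-drift field `φ − A` -/

/-- in-plane increments of the slope-drift field: `D_E(φ − A)(Z) = D_Eφ(Z) − D_Eφ(x₀)` whenever `Σ_j E_j • slopeAt_j = D_Eφ(x₀)`. [this file, g58] -/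
theorem latDiff_sub_affine (φ : Cell 2 → ℤ → E3) (x₀ : Cell 2 × ℤ) {E : Cell 2 × ℤ} (hE : E.2 = 0)
    (hsum : ∑ j, ((E.1 j : ℤ) : ℝ) • slopeAt φ x₀ j = latDiff E φ x₀.1 x₀.2) (Z : Cell 2 × ℤ) :
    latDiff E (φ - modeField (slopeAt φ x₀) 0) Z.1 Z.2 = latDiff E φ Z.1 Z.2 - latDiff E φ x₀.1 x₀.2 := by
  simp only [latDiff_sub, Pi.sub_apply, latDiff_modeField_inPlane _ _ hE, hsum]

/-- first axis: `D₁(φ − A)(Z) = D₁φ(Z) − D₁φ(x₀)`. [formal bookkeeping] -/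
theorem latDiff_axis₁_sub_affine (φ : Cell 2 → ℤ → E3) (x₀ Z : Cell 2 × ℤ) :
    latDiff idxAxis₁ (φ - modeField (slopeAt φ x₀) 0) Z.1 Z.2 = latDiff idxAxis₁ φ Z.1 Z.2 - latDiff idxAxis₁ φ x₀.1 x₀.2 :=
  latDiff_sub_affine φ x₀ idxAxis₁_snd (sum_idxAxis₁_smul_slopeAt φ x₀) Z

/-- second axis: `D₂(φ − A)(Z) = D₂φ(Z) − D₂φ(x₀)`. [formal bookkeeping] -/
theorem latDiff_axis₂_sub_affine (φ : Cell 2 → ℤ → E3) (x₀ Z : Cell 2 × ℤ) :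
    latDiff idxAxis₂ (φ - modeField (slopeAt φ x₀) 0) Z.1 Z.2 = latDiff idxAxis₂ φ Z.1 Z.2 - latDiff idxAxis₂ φ x₀.1 x₀.2 :=
  latDiff_sub_affine φ x₀ idxAxis₂_snd (sum_idxAxis₂_smul_slopeAt φ x₀) Z

/-- vertical increments of the slope-drift field are those of `φ` (the affine part has zero profile). [formal bookkeeping] -/
theorem latDiff_axis₃_sub_affine (φ : Cell 2 → ℤ → E3) (x₀ Z : Cell 2 × ℤ) :
    latDiff idxAxis₃ (φ - modeField (slopeAt φ x₀) 0) Z.1 Z.2 = latDiff idxAxis₃ φ Z.1 Z.2 := by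
  simp only [latDiff_sub, Pi.sub_apply, latDiff_modeField_axis₃, Pi.zero_apply, sub_self, sub_zero]

/-- square roots: `P·s² ≤ A·d²`, `P > 0`, `A, d, s ≥ 0` ⟹ `s ≤ √(A/P)·d`. [formal bookkeeping] -/
theorem le_sqrt_mul_of_sq {P s A d : ℝ} (hP : 0 < P) (hs : 0 ≤ s) (hA : 0 ≤ A) (hd : 0 ≤ d) (h : P * s ^ 2 ≤ A * d ^ 2) :
    s ≤ Real.sqrt (A / P) * d := by
  have h1 : s ^ 2 ≤ (Real.sqrt (A / P) * d) ^ 2 := by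
    rw [mul_pow, Real.sq_sqrt (div_nonneg hA hP.le), div_mul_eq_mul_div, le_div_iff₀ hP]
    linarith
  calc s = Real.sqrt (s ^ 2) := (Real.sqrt_sq hs).symm
    _ ≤ Real.sqrt ((Real.sqrt (A / P) * d) ^ 2) := Real.sqrt_le_sqrt h1
    _ = Real.sqrt (A / P) * d := Real.sqrt_sq (by positivity)

/-- ★ POINTWISE SLOPE DRIFT on the half ball, norm form: for in-plane unit steps `E` and `Z ∈ idxBall x₀ (n/2)`,
`‖D_E(φ − A)(Z)‖ = ‖D_Eφ(Z) − D_Eφ(x₀)‖ ≤ √(864·ipConst·E(φ; idxBall x₀ n)/(n²·#idxBall x₀ n)) · dist Z x₀` (part WM `inPlane_bond_halfBall`).  The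
factor `dist Z x₀` (not a uniform sup) is what keeps the (PC) constant `ϱ`-free downstream. [this file, g58] -/
theorem norm_latDiff_sub_affine_le (hc : 0 < c) (hL : IsLayeredCrystal c a b w) {κ₀ ε ϱ : ℝ} (hκ₀ : 0 < κ₀) (hϱ : 0 ≤ ϱ) (hε : ε < 2 * κ₀)
    (hK : CoerciveZ (layeredKernel a b w) κ₀)
    (hT : ∀ φ : Cell 2 → ℤ → E3, HasFiniteSupport φ → Summable (tailFam ϱ a b w φ) ∧ ∑' x, tailFam ϱ a b w φ x ≤ ε * nnFormZ φ)
    (hP : ∀ E₀ : Cell 2 × ℤ, E₀.2 = 0 → (idxNorm E₀ : ℝ) ≤ 1 → ∀ (y₀ : Cell 2 × ℤ) (r' n' : ℝ), r' < n' → ∀ χ : Cell 2 → ℤ → E3,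
      IsTruncHarmonicZ ϱ a b w χ (idxBall y₀ (n' + 1)) →
        κ₀ * idxEnergy (latDiff E₀ χ) (idxBall y₀ r') ≤ 54 * kernelConst c * ((n' - r')⁻¹) ^ 2 * idxEnergy χ (idxBall y₀ (n' + ϱ / c + 1)))
    (x₀ : Cell 2 × ℤ) {n : ℝ} (hn : 512 * (ϱ / c + 2) ≤ n) {φ : Cell 2 → ℤ → E3} (hφ : IsTruncHarmonicZ ϱ a b w φ (idxBall x₀ n))
    {E : Cell 2 × ℤ} (hE : E.2 = 0) (hE1 : (idxNorm E : ℝ) ≤ 1) (hsum : ∑ j, ((E.1 j : ℤ) : ℝ) • slopeAt φ x₀ j = latDiff E φ x₀.1 x₀.2)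
    {Z : Cell 2 × ℤ} (hZ : Z ∈ idxBall x₀ (n / 2)) :
    ‖latDiff E (φ - modeField (slopeAt φ x₀) 0) Z.1 Z.2‖ ≤
      Real.sqrt (864 * ipConst c κ₀ ε * idxEnergy φ (idxBall x₀ n) / (n ^ 2 * ((idxBall x₀ n).ncard : ℝ))) * dist Z x₀ := by
  have hϱc : 0 ≤ ϱ / c := div_nonneg hϱ hc.le
  have hn0 : 0 < n := by linarith
  have hN := ncard_idxBall_pos x₀ hn0.le
  have hip := ipConst_nonneg hc hκ₀ ε
  have hE0 := idxEnergy_nonneg φ (idxBall x₀ n)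
  have h := inPlane_bond_halfBall hc hL hκ₀ hϱ hε hK hT hP x₀ hn hφ hE hE1 hZ
  rw [latDiff_sub_affine φ x₀ hE hsum]
  refine le_sqrt_mul_of_sq (by positivity) (norm_nonneg _) (by positivity) dist_nonneg ?_
  calc n ^ 2 * ((idxBall x₀ n).ncard : ℝ) * ‖latDiff E φ Z.1 Z.2 - latDiff E φ x₀.1 x₀.2‖ ^ 2
        ≤ 864 * ipConst c κ₀ ε * dist Z x₀ ^ 2 * idxEnergy φ (idxBall x₀ n) := h
    _ = 864 * ipConst c κ₀ ε * idxEnergy φ (idxBall x₀ n) * dist Z x₀ ^ 2 := by ring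

/-! ### WP.3  The closed statement of this part -/

/-- The content of part WP as one closed proposition: the exact reduction of the planar mismatch to the slope-drift field, the axis increments of that
field, and the pointwise bound of its in-plane increments on the half ball. -/
def SlopeMismatchReductionShape : Prop :=
  ∀ c : ℝ, 0 < c → ∀ (a b : E3) (w : ℤ → E3), IsLayeredCrystal c a b w → ∀ κ₀ ε ϱ : ℝ, 0 < κ₀ → 0 ≤ ϱ → ε < 2 * κ₀ →
    CoerciveZ (layeredKernel a b w) κ₀ →
    (∀ φ : Cell 2 → ℤ → E3, HasFiniteSupport φ → Summable (tailFam ϱ a b w φ) ∧ ∑' x, tailFam ϱ a b w φ x ≤ ε * nnFormZ φ) →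
    (∀ E₀ : Cell 2 × ℤ, E₀.2 = 0 → (idxNorm E₀ : ℝ) ≤ 1 → ∀ (y₀ : Cell 2 × ℤ) (r' n' : ℝ), r' < n' → ∀ χ : Cell 2 → ℤ → E3,
      IsTruncHarmonicZ ϱ a b w χ (idxBall y₀ (n' + 1)) →
        κ₀ * idxEnergy (latDiff E₀ χ) (idxBall y₀ r') ≤ 54 * kernelConst c * ((n' - r')⁻¹) ^ 2 * idxEnergy χ (idxBall y₀ (n' + ϱ / c + 1))) →
    ∀ (x₀ : Cell 2 × ℤ) (n : ℝ), 512 * (ϱ / c + 2) ≤ n → ∀ φ : Cell 2 → ℤ → E3, IsTruncHarmonicZ ϱ a b w φ (idxBall x₀ n) →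
      (∀ (T : Finset ℤ) (m : ℤ), Icc (m - ⌊ϱ / c⌋₊) (m + 1 + ⌊ϱ / c⌋₊) ⊆ T → ∀ γ : Cell 2,
        colPlanar ϱ a b w T φ γ m - boxSlope ϱ a b w ⌊ϱ / c⌋₊ (slopeAt φ x₀) m = colPlanar ϱ a b w T (φ - modeField (slopeAt φ x₀) 0) γ m) ∧
      (∀ Z : Cell 2 × ℤ,
        latDiff idxAxis₁ (φ - modeField (slopeAt φ x₀) 0) Z.1 Z.2 = latDiff idxAxis₁ φ Z.1 Z.2 - latDiff idxAxis₁ φ x₀.1 x₀.2 ∧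
          latDiff idxAxis₂ (φ - modeField (slopeAt φ x₀) 0) Z.1 Z.2 = latDiff idxAxis₂ φ Z.1 Z.2 - latDiff idxAxis₂ φ x₀.1 x₀.2 ∧
            latDiff idxAxis₃ (φ - modeField (slopeAt φ x₀) 0) Z.1 Z.2 = latDiff idxAxis₃ φ Z.1 Z.2) ∧
      ∀ Z : Cell 2 × ℤ, Z ∈ idxBall x₀ (n / 2) →
        ‖latDiff idxAxis₁ (φ - modeField (slopeAt φ x₀) 0) Z.1 Z.2‖ ≤
            Real.sqrt (864 * ipConst c κ₀ ε * idxEnergy φ (idxBall x₀ n) / (n ^ 2 * ((idxBall x₀ n).ncard : ℝ))) * dist Z x₀ ∧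
          ‖latDiff idxAxis₂ (φ - modeField (slopeAt φ x₀) 0) Z.1 Z.2‖ ≤
            Real.sqrt (864 * ipConst c κ₀ ε * idxEnergy φ (idxBall x₀ n) / (n ^ 2 * ((idxBall x₀ n).ncard : ℝ))) * dist Z x₀

/-- WP holds. [this file, g58] -/
theorem slopeMismatchReductionShape_holds : SlopeMismatchReductionShape :=
  fun _c hc _a _b _w hL _κ₀ _ε _ϱ hκ₀ hϱ hε hK hT hP x₀ _n hn φ hφ =>
    ⟨fun _T _m hTm γ => colPlanar_sub_boxSlope hc hL φ x₀ hTm γ,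
      fun Z => ⟨latDiff_axis₁_sub_affine φ x₀ Z, latDiff_axis₂_sub_affine φ x₀ Z, latDiff_axis₃_sub_affine φ x₀ Z⟩, fun _Z hZ =>
      ⟨norm_latDiff_sub_affine_le hc hL hκ₀ hϱ hε hK hT hP x₀ hn hφ idxAxis₁_snd idxNorm_idxAxis₁_le (sum_idxAxis₁_smul_slopeAt φ x₀) hZ,
        norm_latDiff_sub_affine_le hc hL hκ₀ hϱ hε hK hT hP x₀ hn hφ idxAxis₂_snd idxNorm_idxAxis₂_le (sum_idxAxis₂_smul_slopeAt φ x₀) hZ⟩⟩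

end SlopeMismatchReduction

end Summit.AtomisticToContinuum.Crystallization.Theorems.ChartedZeroExcessLayeredLatticeLiouville
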